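import Literature.NumberTheory.Sieve.MatomakiRadziwillProp1CoefE1
import Literature.NumberTheory.Sieve.MatomakiRadziwillProp1CoefEj
import Literature.NumberTheory.Sieve.MatomakiRadziwillProp1CoefU3
import Literature.NumberTheory.Sieve.MatomakiRadziwillProp1
import HarnessLib

/-!
# Matomäki–Radziwiłł 2016, Proposition 1 for general coefficients — (e) the conclusion (§8.4)

Topic `NumberTheory/Sieve`.  Everything in this file is PROVED; no definitions, no named facts.

The assembly `MatomakiRadziwill2016_prop1_of_lemma3_lemma11` (`MatomakiRadziwillProp1.lean`) of Proposition 1 of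
K. Matomäki, M. Radziwiłł, *Multiplicative functions in short intervals*, Ann. of Math. 183 (2016), §8, re-run for

* arbitrary `1`-bounded complex coefficients `a` (supported on `𝒮`), `b_j`, `c` with the two factorisations of
  Lemma 12 (`a_{mp} = b_j(m) c_p` on `[P_j, Q_j]`, `a_{mp} = a_m c_p` on `[e^{L^{97/100}}, e^{L^{99/100}}]`, `L = log X`);
* an interval system attached to `X₀` with `e² ≤ X₀ ≤ X`, `log X ≤ 2 log X₀`;
* an integration interval `[T₀, T] ⊆ [0, X]` with `T ≥ 1` (no lower limit `(log X)^{1/15}`);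
* the Halász bound for the cofactor polynomials `R_{v,H}` of §8.3 on `[T₀, T]` as a HYPOTHESIS (`hR`, the `h3` of the
  tree file being used only there): `|R_{v,H}(1+it)| ≤ 2^J · 3 C₃ L^{1/50-1/16}`.

* `integral_dsum_trivial_le` — the trivial bound (Lemma 6) `∫_{T₀}^{T} |∑ a_n n^{-1-it}|² ≤ 10 T/X + 72`;
* `prop1_coef_of_lemma11` — **Proposition 1, general coefficients**: given Lemma 11 (`MatomakiRadziwill2016_lemma11`),
  `0 < η < 1/6` and any real `C₃`, there are `C, L₀` with
  `∫_{T₀}^{T} |∑_{X ≤ n ≤ 2X} a_n n^{-1-it}|² dt ≤ C (T/(X/Q₁) + 1) ((log Q₁)^{1/3}/P₁^{1/6-η} + (log X)^{-1/50})`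
  whenever `log X ≥ L₀` and the data satisfy the hypotheses above.  Proof: §8.4 as in the tree file — the case
  `H₁ < 2` by the trivial bound; otherwise the reduction (23) (`integral_le_sum_Tset_add_Uset_coef`), `E_one_le_coef`,
  `E_j_le_coef`, and `integral_Uset_bound_coef` with the ambient `T' = max(T, X^{1/4})` for Lemmas 8, 9, 11
  (`T' Q₁/X + 1 ≤ 2 (T Q₁/X + 1)`), `4^J ≤ e^{2e^{72}} (log X₀)^{1/200} ≤ e^{2e^{72}} (log X)^{1/200}`.

For a real multiplicative `f` this is Proposition 1 again; for a completely multiplicative complex `f` with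
`a = f 1_𝒮`, `b_j = f 1_{𝒮_j}`, `c = f` and `hR` from Lemma A.4 of Matomäki–Radziwiłł–Tao 2015 it is the range `𝒯₂` of
their Proposition A.3.

## References
* K. Matomäki, M. Radziwiłł, Ann. of Math. (2) 183 (2016), 1015–1056 (arXiv:1501.04585), §8, display (23) and §8.4.
  [cite: MatomakiRadziwillAnnals2016, Proposition 1 (§8.4)]
* K. Matomäki, M. Radziwiłł, T. Tao, Algebra & Number Theory 9 (2015), Appendix A, Proposition A.3 (proof).
  [cite: MatomakiRadziwillTao2015, Appendix A, Proposition A.3 (proof)]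
-/

noncomputable section

open Finset MeasureTheory Filter

namespace Literature.NumberTheory.Sieve

/-! ### The trivial bound for general coefficients -/

/-- **The trivial bound** (Lemma 6): `∫_{T₀}^{T} |∑_{X ≤ n ≤ 2X} a_n n^{-1-it}|² dt ≤ 10 T/X + 72` for `|a| ≤ 1`,
`X ≥ 1`, `0 ≤ T₀ ≤ T`, `0 < T` (the proof of `SieveIntervalSystem.integral_trivial_le` for general coefficients).
[cite: MatomakiRadziwillAnnals2016, §8 (Remark)] -/
theorem integral_dsum_trivial_le {a : ℕ → ℂ} (ha : ∀ n, ‖a n‖ ≤ 1) {X : ℝ} (hX : 1 ≤ X) {T₀ T : ℝ}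
    (hT₀ : 0 ≤ T₀) (hT₀T : T₀ ≤ T) (hT : 0 < T) :
    ∫ t in T₀..T, ‖∑ n ∈ Icc ⌈X⌉₊ ⌊2 * X⌋₊, a n * (n : ℂ) ^ (-(1 + (t : ℂ) * Complex.I))‖ ^ 2 ≤
      10 * T / X + 72 := by
  have hX0 : 0 < X := by linarith
  have hsub : Icc ⌈X⌉₊ ⌊2 * X⌋₊ ⊆ Icc 1 ⌊2 * X⌋₊ := MatomakiRadziwillLemma12.Nn_subset hX0
  have hIcc : Set.Icc T₀ T ⊆ Set.Icc (-T) T := Set.Icc_subset_Icc (by linarith) le_rfl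
  have h := MatomakiRadziwillLemma12.meanvalue_subset (Icc ⌈X⌉₊ ⌊2 * X⌋₊) ⌊2 * X⌋₊ hsub a hT hIcc
  rw [intervalIntegral.integral_of_le hT₀T, ← integral_Icc_eq_integral_Ioc]
  refine h.trans ?_
  have hM : (⌊2 * X⌋₊ : ℝ) ≤ 2 * X := Nat.floor_le (by positivity)
  have hterm : ∀ n ∈ Icc ⌈X⌉₊ ⌊2 * X⌋₊, ‖a n‖ ^ 2 / (n : ℝ) ^ 2 ≤ 1 / X ^ 2 := by
    intro n hn
    have hXn : X ≤ n := Nat.ceil_le.1 (mem_Icc.1 hn).1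
    have h1 : ‖a n‖ ^ 2 ≤ 1 := by
      have := ha n
      have h0 := norm_nonneg (a n)
      nlinarith only [this, h0]
    calc ‖a n‖ ^ 2 / (n : ℝ) ^ 2 ≤ 1 / (n : ℝ) ^ 2 := div_le_div_of_nonneg_right h1 (by positivity)
      _ ≤ 1 / X ^ 2 := div_le_div_of_nonneg_left zero_le_one (by positivity) (pow_le_pow_left₀ hX0.le hXn 2)
  have hcard : (#(Icc ⌈X⌉₊ ⌊2 * X⌋₊) : ℝ) ≤ X + 1 := by
    calc (#(Icc ⌈X⌉₊ ⌊2 * X⌋₊) : ℝ) = ((⌊2 * X⌋₊ + 1 - ⌈X⌉₊ : ℕ) : ℝ) := by rw [Nat.card_Icc]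
      _ ≤ X + 1 := by
          rcases le_or_gt ⌈X⌉₊ (⌊2 * X⌋₊ + 1) with hle | hlt
          · rw [Nat.cast_sub hle]; push_cast; linarith [Nat.le_ceil X]
          · rw [Nat.sub_eq_zero_of_le hlt.le]; push_cast; linarith
  calc (5 * T + 18 * (⌊2 * X⌋₊ : ℝ)) * ∑ n ∈ Icc ⌈X⌉₊ ⌊2 * X⌋₊, ‖a n‖ ^ 2 / (n : ℝ) ^ 2
      ≤ (5 * T + 36 * X) * ∑ n ∈ Icc ⌈X⌉₊ ⌊2 * X⌋₊, (1 / X ^ 2 : ℝ) :=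
        mul_le_mul (by linarith) (sum_le_sum hterm) (sum_nonneg fun n _ => by positivity) (by positivity)
    _ = (5 * T + 36 * X) * (#(Icc ⌈X⌉₊ ⌊2 * X⌋₊) * (1 / X ^ 2)) := by rw [sum_const, nsmul_eq_mul]
    _ ≤ (5 * T + 36 * X) * ((X + 1) * (1 / X ^ 2)) := by gcongr
    _ ≤ (5 * T + 36 * X) * (2 / X) := by
        refine mul_le_mul_of_nonneg_left ?_ (by positivity)
        rw [show (X + 1) * (1 / X ^ 2) = (X + 1) / X ^ 2 by ring, div_le_div_iff₀ (by positivity) hX0]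
        nlinarith
    _ = 10 * T / X + 72 := by field_simp; ring

/-! ### Proposition 1 for general coefficients -/

set_option maxHeartbeats 800000 in
/-- **Matomäki–Radziwiłł 2016, Proposition 1, for general coefficients, from Lemma 11** (§8.4 of the printed proof,
re-assembled from `…CoefE1`, `…CoefEj`, `…CoefU3`; Lemma 13 enters through `MatomakiRadziwill2016_lemma13_holds`,
Lemmas 8♯ and 9 through `MatomakiRadziwillU.lemma8With_exists` / `lemma9With_exists`, Brun–Titchmarsh through
`card_primes_Ioc_le`, the sieve bound through `card_Icc_filter_forall_not_dvd_le`, the size conditions through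
`MatomakiRadziwillProp1.eventually_size`).  See the module docstring for the hypotheses on `a, b, c`, `X₀`, `[T₀, T]`
and `hR`. [cite: MatomakiRadziwillAnnals2016, Proposition 1 (§8.4)] -/
theorem prop1_coef_of_lemma11 (h11 : MatomakiRadziwill2016_lemma11) {η : ℝ} (hη : 0 < η) (hη6 : η < 1 / 6)
    (C₃ : ℝ) :
    ∃ C L₀ : ℝ, 0 ≤ C ∧ ∀ (X X₀ : ℝ) (I : SieveIntervalSystem η X₀) (a c : ℕ → ℂ) (b : ℕ → ℕ → ℂ) (T₀ T : ℝ),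
      L₀ ≤ Real.log X → Real.exp 2 ≤ X₀ → X₀ ≤ X → Real.log X ≤ 2 * Real.log X₀ →
      (∀ n, ‖a n‖ ≤ 1) → (∀ j m, ‖b j m‖ ≤ 1) → (∀ p, ‖c p‖ ≤ 1) → (∀ n, a n ≠ 0 → I.Mem n) →
      (∀ j ∈ Icc 1 I.J, ∀ m p : ℕ, p.Prime → I.P j ≤ p → (p : ℝ) ≤ I.Q j → ¬ p ∣ m →
        a (m * p) = b j m * c p) →
      (∀ m p : ℕ, p.Prime → Real.exp (Real.log X ^ (97 / 100 : ℝ)) ≤ p →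
        (p : ℝ) ≤ Real.exp (Real.log X ^ (99 / 100 : ℝ)) → ¬ p ∣ m → a (m * p) = a m * c p) →
      0 ≤ T₀ → T₀ ≤ T → 1 ≤ T → T ≤ X →
      (∀ v ∈ Icc ⌊Real.log X ^ (1 / 50 : ℝ) * Real.log (Real.exp (Real.log X ^ (97 / 100 : ℝ)))⌋₊
          ⌊Real.log X ^ (1 / 50 : ℝ) * Real.log (Real.exp (Real.log X ^ (99 / 100 : ℝ)))⌋₊,
        ∀ t ∈ Set.Icc T₀ T,
          ‖blockCofactorPoly a X (Real.exp (Real.log X ^ (97 / 100 : ℝ))) (Real.exp (Real.log X ^ (99 / 100 : ℝ)))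
              (Real.log X ^ (1 / 50 : ℝ)) v t‖ ≤ 2 ^ I.J * (3 * C₃ * Real.log X ^ (1 / 50 - 1 / 16 : ℝ))) →
      ∫ t in T₀..T, ‖∑ n ∈ Icc ⌈X⌉₊ ⌊2 * X⌋₊, a n * (n : ℂ) ^ (-(1 + (t : ℂ) * Complex.I))‖ ^ 2 ≤
        C * (T / (X / I.Q 1) + 1) *
          (Real.log (I.Q 1) ^ (1 / 3 : ℝ) / I.P 1 ^ (1 / 6 - η) + 1 / Real.log X ^ (1 / 50 : ℝ)) := by
  have hη' : η ≤ 8 := by linarith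
  classical
  -- the constants of the inputs
  obtain ⟨C₁₃, h13⟩ := MatomakiRadziwill2016_lemma13_holds
  obtain ⟨C₈, hC₈, h8⟩ := MatomakiRadziwillU.lemma8With_exists
  obtain ⟨C₉, hC₉, h9⟩ := MatomakiRadziwillU.lemma9With_exists
  obtain ⟨C₁₁, hC₁₁, h11'⟩ := MatomakiRadziwillU.lemma11With_of h11
  obtain ⟨C, hC, hBT⟩ := card_primes_Ioc_le
  obtain ⟨K, hK0, hK⟩ := card_Icc_filter_forall_not_dvd_le
  -- the threshold `L₀`
  obtain ⟨L₀, hL₀⟩ := Filter.eventually_atTop.1 (MatomakiRadziwillProp1.eventually_size hη)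
  -- the constants of §8.4
  have hα : 0 < SieveIntervalSystem.alpha η 1 := by rw [SieveIntervalSystem.alpha_one]; linarith
  obtain ⟨K₁, hK₁⟩ : ∃ K₁ : ℝ, K₁ = 2880000 * (1 + 1 / (2 * SieveIntervalSystem.alpha η 1)) +
      100000000 * max C₁₃ 0 + 40000 := ⟨_, rfl⟩
  obtain ⟨K₂, hK₂⟩ : ∃ K₂ : ℝ, K₂ = 20000 * (2 + K * (2 * Real.exp 6 + 1)) +
      160000 * C₉ * (4 + 4 ^ 20 * C₈) +
      17280000 * C₃ ^ 2 * C₁₁ * C * (1 + C₈) * Real.exp (2 * Real.exp 72) := ⟨_, rfl⟩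
  have hK₁0 : 0 ≤ K₁ := by rw [hK₁]; positivity
  have hK₂0 : 0 ≤ K₂ := by rw [hK₂]; positivity
  refine ⟨164 + 4 * K₁ + 2 * K₂, L₀, by positivity, ?_⟩
  intro X X₀ I a c b T₀ T hLL₀ hX₀ hX₀X hLX₀ ha hb hc hsupp hfac hfacU hT₀ hT₀T hT1 hTX hR
  -- sizes of `X`, `L = log X`, `T`
  have hX₀0 : 0 < X₀ := (Real.exp_pos 2).trans_le hX₀
  have hX0 : 0 < X := hX₀0.trans_le hX₀X
  obtain ⟨hL4, c2, c3, c4, c5, c6, c7⟩ := hL₀ (Real.log X) hLL₀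
  have hL1 : 1 ≤ Real.log X := by linarith
  have hL0 : 0 < Real.log X := by linarith
  have hXe : Real.exp 1 ≤ X := by
    rw [← Real.exp_log hX0]; exact Real.exp_le_exp.2 hL1
  have hX1 : 1 ≤ X := le_trans (by have := Real.add_one_le_exp (1 : ℝ); linarith) hXe
  have hX₀e : Real.exp 1 ≤ X₀ := (Real.exp_le_exp.2 (by norm_num)).trans hX₀
  have hTpos : 0 < T := by linarith
  -- the interval system
  have hH0 : 0 < I.Hpar 1 := I.Hpar_one_pos hη hη'
  have hH0' : 0 < 1 / I.Hpar 1 := by positivity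
  have hQ1 : 1 ≤ I.Q 1 := I.one_le_Q hη hη' le_rfl
  have hQ0 : 0 < I.Q 1 := by linarith
  have hQX : I.Q 1 ≤ X := (I.Q_one_le_X hη hη' hX₀e).trans hX₀X
  -- rewrite the target in terms of `R = T Q₁/X + 1` and `E = 1/H₁ + 1/L^{1/50}`
  rw [div_div_eq_mul_div, ← I.one_div_Hpar_one]
  have hLr0 : 0 < Real.log X ^ (1 / 50 : ℝ) := Real.rpow_pos_of_pos hL0 _
  have hE0 : 0 < 1 / I.Hpar 1 + 1 / Real.log X ^ (1 / 50 : ℝ) := by positivity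
  have hR1 : 1 ≤ T * I.Q 1 / X + 1 := by
    have : 0 ≤ T * I.Q 1 / X := by positivity
    linarith
  by_cases hH1 : I.Hpar 1 < 2
  · -- `H₁ < 2`: the trivial bound (`1/H₁ > 1/2`)
    have htriv := integral_dsum_trivial_le ha hX1 hT₀ hT₀T hTpos
    have h82 : 10 * T / X + 72 ≤ 82 := by
      have : T / X ≤ 1 := by rw [div_le_one hX0]; exact hTX
      have h' : 10 * T / X = 10 * (T / X) := by ring
      linarith
    have hhalf : 1 / 2 ≤ 1 / I.Hpar 1 := one_div_le_one_div_of_le hH0 hH1.le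
    have hE : 1 / 2 ≤ (T * I.Q 1 / X + 1) * (1 / I.Hpar 1 + 1 / Real.log X ^ (1 / 50 : ℝ)) := by
      have hb : 0 ≤ 1 / Real.log X ^ (1 / 50 : ℝ) := by positivity
      have hprod := mul_nonneg (sub_nonneg.2 hR1) hE0.le
      linarith
    have hRE0 : 0 ≤ (T * I.Q 1 / X + 1) * (1 / I.Hpar 1 + 1 / Real.log X ^ (1 / 50 : ℝ)) := by positivity
    linarith [mul_nonneg hK₁0 hRE0, mul_nonneg hK₂0 hRE0]
  push Not at hH1
  -- the main case `H₁ ≥ 2`; the ambient `T' = max(T, X^{1/4})` for the `𝒰`-part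
  set T' : ℝ := max T (X ^ (1 / 4 : ℝ)) with hT'
  have hTT' : T ≤ T' := le_max_left _ _
  have hXT' : X ^ (1 / 4 : ℝ) ≤ T' := le_max_right _ _
  have hX14 : X ^ (1 / 4 : ℝ) ≤ X := by
    conv_rhs => rw [← Real.rpow_one X]
    exact Real.rpow_le_rpow_of_exponent_le hX1 (by norm_num)
  have hT'X : T' ≤ X := max_le hTX hX14
  have hT'1 : 1 ≤ T' := hT1.trans hTT'
  have hT'0 : 0 ≤ T' := by linarith
  -- `R = T Q₁/X + 1`, `R' = T' Q₁/X + 1 ≤ 2 R`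
  obtain ⟨R, hRdef⟩ : ∃ R : ℝ, R = T * I.Q 1 / X + 1 := ⟨_, rfl⟩
  obtain ⟨R', hR'⟩ : ∃ R' : ℝ, R' = T' * I.Q 1 / X + 1 := ⟨_, rfl⟩
  have hR1' : 1 ≤ R := by rw [hRdef]; exact hR1
  have hR0 : 0 ≤ R := by linarith
  have hR'1 : 1 ≤ R' := by
    have : 0 ≤ T' * I.Q 1 / X := by positivity
    linarith
  have hR'0 : 0 ≤ R' := by linarith
  have hTXR : (T + X) / X ≤ R := by
    rw [hRdef]
    have h1 : (T + X) / X = T / X + 1 := by field_simp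
    rw [h1]
    have : T / X ≤ T * I.Q 1 / X := by
      rw [mul_div_right_comm]
      exact le_mul_of_one_le_right (by positivity) hQ1
    linarith
  have hTXR0 : T / X + 1 ≤ R := by
    have : (T + X) / X = T / X + 1 := by field_simp
    rw [← this]; exact hTXR
  have hTXR' : T' / X + 1 ≤ R' := by
    rw [hR']
    have : T' / X ≤ T' * I.Q 1 / X := by
      rw [mul_div_right_comm]
      exact le_mul_of_one_le_right (by positivity) hQ1
    linarith
  have hR'R : R' ≤ 2 * R := by
    have hsqrt : Real.sqrt (Real.log X) ≤ 3 / 4 * Real.log X := by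
      have hs0 := Real.sqrt_nonneg (Real.log X)
      have hsq : Real.sqrt (Real.log X) * Real.sqrt (Real.log X) = Real.log X := Real.mul_self_sqrt hL0.le
      have hs2 : 2 ≤ Real.sqrt (Real.log X) := by nlinarith
      have := mul_nonneg hs0 (by linarith : 0 ≤ 3 / 4 * Real.sqrt (Real.log X) - 1)
      linarith
    have hQ1X : I.Q 1 ≤ Real.exp (Real.sqrt (Real.log X)) :=
      (I.Q_one_le hη hη').trans (Real.exp_le_exp.2 (Real.sqrt_le_sqrt (Real.log_le_log hX₀0 hX₀X)))
    have hXQ : X ^ (1 / 4 : ℝ) * I.Q 1 ≤ X := by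
      calc X ^ (1 / 4 : ℝ) * I.Q 1 ≤ X ^ (1 / 4 : ℝ) * Real.exp (Real.sqrt (Real.log X)) :=
            mul_le_mul_of_nonneg_left hQ1X (Real.rpow_nonneg hX0.le _)
        _ = Real.exp (Real.log X * (1 / 4) + Real.sqrt (Real.log X)) := by
            rw [Real.exp_add, Real.rpow_def_of_pos hX0]
        _ ≤ Real.exp (Real.log X) := Real.exp_le_exp.2 (by linarith)
        _ = X := Real.exp_log hX0
    have hT'le : T' ≤ T + X ^ (1 / 4 : ℝ) := max_le (by linarith [Real.rpow_nonneg hX0.le (1 / 4 : ℝ)])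
      (by linarith)
    have h1 : T' * I.Q 1 / X ≤ T * I.Q 1 / X + 1 := by
      rw [div_le_iff₀ hX0, add_mul, div_mul_cancel₀ _ hX0.ne']
      linarith [mul_le_mul_of_nonneg_right hT'le hQ0.le]
    rw [hR', hRdef]
    linarith [hR1]
  -- (ii) the reduction (23) on `[T₀, T]`
  have hpart := I.integral_le_sum_Tset_add_Uset_coef hη hη' a c b ha hb hc hsupp hX1 hT₀ hT₀T hT1
    (fun j hj => le_trans (by linarith : (1 : ℝ) ≤ I.Hpar 1) (I.Hpar_one_le hη hη' (mem_Icc.1 hj).1)) hfac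
  -- (iii) the `𝒯_j`-terms: `E_1`, `E_j` and the remainders of Lemma 12
  have hj_bound : ∀ j ∈ Icc 1 I.J,
      20000 * ((I.Hpar j * Real.log (I.Q j / I.P j)) *
          (∑ v ∈ I.blocks j, ∫ t in I.Tset c T₀ T j,
            ‖blockPrimePoly c (I.P j) (I.Q j) (I.Hpar j) v t *
              blockCofactorPoly (b j) X (I.P j) (I.Q j) (I.Hpar j) v t‖ ^ 2)
        + (T + X) / X * (1 / I.Hpar j + 1 / I.P j)) ≤
      K₁ * R * (1 / I.Hpar 1) * (1 / (j : ℝ) ^ 2) := by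
    intro j hj
    have hj1 : 1 ≤ j := (mem_Icc.1 hj).1
    have hjR : (1 : ℝ) ≤ j := by exact_mod_cast hj1
    have hjsq : 0 < (j : ℝ) ^ 2 := by positivity
    have hjsq' : 0 < 1 / (j : ℝ) ^ 2 := by positivity
    have hHj : 1 / I.Hpar j = 1 / (j : ℝ) ^ 2 * (1 / I.Hpar 1) := by
      rw [I.Hpar_eq j, one_div_mul_one_div]
    have hPj : 1 / I.P j ≤ 1 / (j : ℝ) ^ 2 * (1 / I.Hpar 1) := by
      rcases eq_or_lt_of_le hj1 with h | h
      · rw [← h]; simpa using I.inv_P_one_le hη hη6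
      · have hj2 : 2 ≤ j := h
        have hsq := I.sq_mul_Q_pred_le_P hη hη6 hj2
        have hQP : I.P 1 ≤ I.Q (j - 1) := I.P_one_le_Q_pred hη hη' hj2
        have hP0 : 0 < I.P 1 := I.pos_P 1 le_rfl
        have hQpos : 0 < I.Q (j - 1) := I.pos_Q (by omega)
        calc 1 / I.P j ≤ 1 / ((j : ℝ) ^ 2 * I.Q (j - 1)) := one_div_le_one_div_of_le (by positivity) hsq
          _ ≤ 1 / ((j : ℝ) ^ 2 * I.P 1) :=
              one_div_le_one_div_of_le (by positivity) (mul_le_mul_of_nonneg_left hQP hjsq.le)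
          _ = 1 / (j : ℝ) ^ 2 * (1 / I.P 1) := by rw [one_div_mul_one_div]
          _ ≤ 1 / (j : ℝ) ^ 2 * (1 / I.Hpar 1) :=
              mul_le_mul_of_nonneg_left (I.inv_P_one_le hη hη6) hjsq'.le
    have hB : 20000 * ((T + X) / X * (1 / I.Hpar j + 1 / I.P j)) ≤
        40000 * R * (1 / I.Hpar 1) * (1 / (j : ℝ) ^ 2) := by
      have h1 : 1 / I.Hpar j + 1 / I.P j ≤ 2 * (1 / (j : ℝ) ^ 2 * (1 / I.Hpar 1)) := by
        rw [hHj]; linarith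
      have h0 : 0 ≤ 1 / I.Hpar j + 1 / I.P j := by
        have := I.pos_P j hj1
        have := (hH0.trans_le (I.Hpar_one_le hη hη' hj1))
        positivity
      calc 20000 * ((T + X) / X * (1 / I.Hpar j + 1 / I.P j))
          ≤ 20000 * (R * (2 * (1 / (j : ℝ) ^ 2 * (1 / I.Hpar 1)))) := by
            gcongr 20000 * ?_
            exact mul_le_mul hTXR h1 h0 hR0
        _ = 40000 * R * (1 / I.Hpar 1) * (1 / (j : ℝ) ^ 2) := by ring
    have hE : 20000 * ((I.Hpar j * Real.log (I.Q j / I.P j)) *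
        (∑ v ∈ I.blocks j, ∫ t in I.Tset c T₀ T j,
          ‖blockPrimePoly c (I.P j) (I.Q j) (I.Hpar j) v t *
            blockCofactorPoly (b j) X (I.P j) (I.Q j) (I.Hpar j) v t‖ ^ 2)) ≤
        (K₁ - 40000) * R * (1 / I.Hpar 1) * (1 / (j : ℝ) ^ 2) := by
      rcases eq_or_lt_of_le hj1 with h | h
      · -- `j = 1`: §8.1
        subst h
        have hE1 := I.E_one_le_coef hη hη6 c (b 1) (hb 1) hX₀e hX₀X hT₀ hT1 (by linarith : 1 ≤ I.Hpar 1)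
        rw [← hRdef] at hE1
        refine hE1.trans ?_
        have hc' : 2880000 * (1 + 1 / (2 * SieveIntervalSystem.alpha η 1)) ≤ K₁ - 40000 := by
          rw [hK₁]
          have : 0 ≤ 100000000 * max C₁₃ 0 := by positivity
          linarith
        have := mul_le_mul_of_nonneg_right hc' (mul_nonneg hR0 hH0'.le)
        simp only [Nat.cast_one, one_pow, div_one, mul_one]
        linarith
      · -- `j ≥ 2`: §8.2
        have hj2 : 2 ≤ j := h
        have hEj := I.E_j_le_coef h13 hη hη6 c (b j) hc (hb j) hX1 hT₀ hT1 hj2 hH1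
        refine hEj.trans ?_
        have hQP : I.P 1 ≤ I.Q (j - 1) := I.P_one_le_Q_pred hη hη' hj2
        have hP0 : 0 < I.P 1 := I.pos_P 1 le_rfl
        have hQpos : 0 < I.Q (j - 1) := I.pos_Q (by omega)
        have hfrac : (T / X + 1) / ((j : ℝ) ^ 2 * I.Q (j - 1)) ≤ R * (1 / I.Hpar 1) * (1 / (j : ℝ) ^ 2) := by
          have h1 : 1 / ((j : ℝ) ^ 2 * I.Q (j - 1)) ≤ 1 / (j : ℝ) ^ 2 * (1 / I.Hpar 1) := by
            calc 1 / ((j : ℝ) ^ 2 * I.Q (j - 1)) ≤ 1 / ((j : ℝ) ^ 2 * I.P 1) :=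
                  one_div_le_one_div_of_le (by positivity) (mul_le_mul_of_nonneg_left hQP hjsq.le)
              _ = 1 / (j : ℝ) ^ 2 * (1 / I.P 1) := by rw [one_div_mul_one_div]
              _ ≤ 1 / (j : ℝ) ^ 2 * (1 / I.Hpar 1) :=
                  mul_le_mul_of_nonneg_left (I.inv_P_one_le hη hη6) hjsq'.le
          have h0 : 0 ≤ T / X + 1 := by positivity
          calc (T / X + 1) / ((j : ℝ) ^ 2 * I.Q (j - 1)) = (T / X + 1) * (1 / ((j : ℝ) ^ 2 * I.Q (j - 1))) := by
                rw [mul_one_div]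
            _ ≤ R * (1 / (j : ℝ) ^ 2 * (1 / I.Hpar 1)) := mul_le_mul hTXR0 h1 (by positivity) hR0
            _ = R * (1 / I.Hpar 1) * (1 / (j : ℝ) ^ 2) := by ring
        have hc' : 100000000 * max C₁₃ 0 ≤ K₁ - 40000 := by
          rw [hK₁]
          have : 0 ≤ 2880000 * (1 + 1 / (2 * SieveIntervalSystem.alpha η 1)) := by positivity
          linarith
        calc 100000000 * max C₁₃ 0 * (T / X + 1) / ((j : ℝ) ^ 2 * I.Q (j - 1))
            = 100000000 * max C₁₃ 0 * ((T / X + 1) / ((j : ℝ) ^ 2 * I.Q (j - 1))) := by ring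
          _ ≤ (K₁ - 40000) * (R * (1 / I.Hpar 1) * (1 / (j : ℝ) ^ 2)) :=
              mul_le_mul hc' hfrac (by positivity) (by linarith [le_max_right C₁₃ 0])
          _ = (K₁ - 40000) * R * (1 / I.Hpar 1) * (1 / (j : ℝ) ^ 2) := by ring
    rw [mul_add]
    linarith
  have hsumT : (∑ j ∈ Icc 1 I.J, 20000 * ((I.Hpar j * Real.log (I.Q j / I.P j)) *
          (∑ v ∈ I.blocks j, ∫ t in I.Tset c T₀ T j,
            ‖blockPrimePoly c (I.P j) (I.Q j) (I.Hpar j) v t *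
              blockCofactorPoly (b j) X (I.P j) (I.Q j) (I.Hpar j) v t‖ ^ 2)
        + (T + X) / X * (1 / I.Hpar j + 1 / I.P j))) ≤ 2 * K₁ * R * (1 / I.Hpar 1) := by
    calc _ ≤ ∑ j ∈ Icc 1 I.J, K₁ * R * (1 / I.Hpar 1) * (1 / (j : ℝ) ^ 2) := sum_le_sum hj_bound
      _ = K₁ * R * (1 / I.Hpar 1) * ∑ j ∈ Icc 1 I.J, 1 / (j : ℝ) ^ 2 := by rw [mul_sum]
      _ ≤ K₁ * R * (1 / I.Hpar 1) * 2 :=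
          mul_le_mul_of_nonneg_left (SieveIntervalSystem.sum_Icc_inv_sq_le_two _) (by positivity)
      _ = 2 * K₁ * R * (1 / I.Hpar 1) := by ring
  -- (iv) the `𝒰`-term, with the ambient `T'`
  have hU := I.integral_Uset_bound_coef hC₈ h8 hC₉ h9 hC₁₁ h11' hC.le hBT hK0.le hK hη hη6 a c ha hc hXe hX₀ hX₀X
    hLX₀ c2 c3 c4 c5 c6 c7 hT₀ hXT' hT'X hTT' hH1 hfacU hR
  have hL1₀ : 1 ≤ Real.log X₀ := by rw [← Real.log_exp 1]; exact Real.log_le_log (Real.exp_pos 1) hX₀e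
  have hJ : (4 : ℝ) ^ I.J ≤ Real.exp (2 * Real.exp 72) * Real.log X ^ (1 / 200 : ℝ) :=
    (I.four_pow_J_le hη hη6 hL1₀).trans (mul_le_mul_of_nonneg_left
      (Real.rpow_le_rpow (by linarith) (Real.log_le_log hX₀0 hX₀X) (by norm_num)) (by positivity))
  have hneg50 : Real.log X ^ (-(1 / 50) : ℝ) = 1 / Real.log X ^ (1 / 50 : ℝ) := by
    rw [Real.rpow_neg hL0.le, inv_eq_one_div]
  have hneg40 : (4 : ℝ) ^ I.J * Real.log X ^ (-(1 / 40) : ℝ) ≤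
      Real.exp (2 * Real.exp 72) * (1 / Real.log X ^ (1 / 50 : ℝ)) := by
    have h1 : Real.log X ^ (1 / 200 : ℝ) * Real.log X ^ (-(1 / 40) : ℝ) = 1 / Real.log X ^ (1 / 50 : ℝ) := by
      rw [← Real.rpow_add hL0, ← hneg50]; norm_num
    calc (4 : ℝ) ^ I.J * Real.log X ^ (-(1 / 40) : ℝ)
        ≤ (Real.exp (2 * Real.exp 72) * Real.log X ^ (1 / 200 : ℝ)) * Real.log X ^ (-(1 / 40) : ℝ) :=
          mul_le_mul_of_nonneg_right hJ (Real.rpow_nonneg hL0.le _)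
      _ = Real.exp (2 * Real.exp 72) * (1 / Real.log X ^ (1 / 50 : ℝ)) := by rw [mul_assoc, h1]
  have hUfin : ∫ t in I.Uset c T₀ T,
        ‖∑ n ∈ Icc ⌈X⌉₊ ⌊2 * X⌋₊, a n * (n : ℂ) ^ (-(1 + (t : ℂ) * Complex.I))‖ ^ 2 ≤
      K₂ * R' * (1 / Real.log X ^ (1 / 50 : ℝ)) := by
    refine hU.trans ?_
    rw [hneg50]
    have hA0 : 0 ≤ 20000 * (2 + K * (2 * Real.exp 6 + 1)) := by positivity
    have hB0 : 0 ≤ 160000 * C₉ * (4 + 4 ^ 20 * C₈) := by positivity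
    have hD0 : 0 ≤ 17280000 * C₃ ^ 2 * C₁₁ * C * (1 + C₈) := by positivity
    have hi0 : 0 ≤ 1 / Real.log X ^ (1 / 50 : ℝ) := by positivity
    have t1 : (T' / X + 1) * (20000 * (2 + K * (2 * Real.exp 6 + 1))) * (1 / Real.log X ^ (1 / 50 : ℝ)) ≤
        R' * (20000 * (2 + K * (2 * Real.exp 6 + 1))) * (1 / Real.log X ^ (1 / 50 : ℝ)) :=
      mul_le_mul_of_nonneg_right (mul_le_mul_of_nonneg_right hTXR' hA0) hi0
    have t2 : 160000 * C₉ * (4 + 4 ^ 20 * C₈) * (1 / Real.log X ^ (1 / 50 : ℝ)) ≤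
        R' * (160000 * C₉ * (4 + 4 ^ 20 * C₈)) * (1 / Real.log X ^ (1 / 50 : ℝ)) :=
      mul_le_mul_of_nonneg_right
        (le_mul_of_one_le_left hB0 hR'1 : 160000 * C₉ * (4 + 4 ^ 20 * C₈) ≤ R' * (160000 * C₉ * (4 + 4 ^ 20 * C₈))) hi0
    have t3 : 17280000 * C₃ ^ 2 * C₁₁ * C * (1 + C₈) * 4 ^ I.J * Real.log X ^ (-(1 / 40) : ℝ) ≤
        R' * (17280000 * C₃ ^ 2 * C₁₁ * C * (1 + C₈) * Real.exp (2 * Real.exp 72)) *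
          (1 / Real.log X ^ (1 / 50 : ℝ)) := by
      calc 17280000 * C₃ ^ 2 * C₁₁ * C * (1 + C₈) * 4 ^ I.J * Real.log X ^ (-(1 / 40) : ℝ)
          = 17280000 * C₃ ^ 2 * C₁₁ * C * (1 + C₈) * ((4 : ℝ) ^ I.J * Real.log X ^ (-(1 / 40) : ℝ)) := by ring
        _ ≤ 17280000 * C₃ ^ 2 * C₁₁ * C * (1 + C₈) *
              (Real.exp (2 * Real.exp 72) * (1 / Real.log X ^ (1 / 50 : ℝ))) :=
            mul_le_mul_of_nonneg_left hneg40 hD0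
        _ = 1 * ((17280000 * C₃ ^ 2 * C₁₁ * C * (1 + C₈) * Real.exp (2 * Real.exp 72)) *
              (1 / Real.log X ^ (1 / 50 : ℝ))) := by ring
        _ ≤ R' * ((17280000 * C₃ ^ 2 * C₁₁ * C * (1 + C₈) * Real.exp (2 * Real.exp 72)) *
              (1 / Real.log X ^ (1 / 50 : ℝ))) :=
            mul_le_mul_of_nonneg_right hR'1 (by positivity)
        _ = _ := by ring
    rw [hK₂]
    linarith [t1, t2, t3]
  -- (v) conclusion
  have hfin : 2 * K₁ * R * (1 / I.Hpar 1) + K₂ * R' * (1 / Real.log X ^ (1 / 50 : ℝ)) ≤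
      (164 + 4 * K₁ + 2 * K₂) * (T * I.Q 1 / X + 1) * (1 / I.Hpar 1 + 1 / Real.log X ^ (1 / 50 : ℝ)) := by
    have hi0 : 0 ≤ 1 / Real.log X ^ (1 / 50 : ℝ) := by positivity
    rw [← hRdef]
    have a2 : K₂ * R' * (1 / Real.log X ^ (1 / 50 : ℝ)) ≤
        K₂ * (2 * R) * (1 / Real.log X ^ (1 / 50 : ℝ)) :=
      mul_le_mul_of_nonneg_right (mul_le_mul_of_nonneg_left hR'R hK₂0) hi0
    linarith [mul_nonneg hR0 hi0, mul_nonneg hR0 hH0'.le, mul_nonneg (mul_nonneg hK₁0 hR0) hi0,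
      mul_nonneg (mul_nonneg hK₂0 hR0) hH0'.le, mul_nonneg (mul_nonneg hK₁0 hR0) hH0'.le]
  calc ∫ t in T₀..T, ‖∑ n ∈ Icc ⌈X⌉₊ ⌊2 * X⌋₊, a n * (n : ℂ) ^ (-(1 + (t : ℂ) * Complex.I))‖ ^ 2
      ≤ _ := hpart
    _ ≤ 2 * K₁ * R * (1 / I.Hpar 1) + K₂ * R' * (1 / Real.log X ^ (1 / 50 : ℝ)) := add_le_add hsumT hUfin
    _ ≤ _ := hfin

end Literature.NumberTheory.Sieve
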